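import Summits.CriticalPhenomena.PercolationContinuityZ3.Theorems.Transplant.SkelFrmBParamsReachFC
import Summits.CriticalPhenomena.PercolationContinuityZ3.Theorems.Transplant.SkelNegBParamsReachFC
import Summits.CriticalPhenomena.PercolationContinuityZ3.Theorems.Transplant.SkelPhiRootFoot
import Summits.CriticalPhenomena.PercolationContinuityZ3.Theorems.Transplant.SkelFrm1SlotTypes
import Summits.CriticalPhenomena.PercolationContinuityZ3.Theorems.Transplant.SkelFrm1ParamsPO
import Summits.CriticalPhenomena.PercolationContinuityZ3.Theorems.Transplant.SkelFrm1ParamsLBL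
import Summits.CriticalPhenomena.PercolationContinuityZ3.Theorems.Transplant.SkelFrmBParamsKitA
import Summits.CriticalPhenomena.PercolationContinuityZ3.Theorems.Transplant.SkelFrmBParamsKitS
import Summits.CriticalPhenomena.PercolationContinuityZ3.Theorems.Transplant.SkelFrm1ParamsLF
import Summits.CriticalPhenomena.PercolationContinuityZ3.Theorems.Transplant.SkelFrm1ParamsLO
import Summits.CriticalPhenomena.PercolationContinuityZ3.Theorems.Transplant.SkelFrmBParamsLF
import Summits.CriticalPhenomena.PercolationContinuityZ3.Theorems.Transplant.SkelFrmBParamsFineSize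
import Summits.CriticalPhenomena.PercolationContinuityZ3.Theorems.Transplant.SkelFrmBParamsLO
import Summits.CriticalPhenomena.PercolationContinuityZ3.Theorems.Transplant.SkelFrmBParamsB
import Summits.CriticalPhenomena.PercolationContinuityZ3.Theorems.Transplant.SkelFrmBParamsSlotsR
import Summits.CriticalPhenomena.PercolationContinuityZ3.Theorems.Transplant.SkelFrmBParamsSlotsRS
import Summits.CriticalPhenomena.PercolationContinuityZ3.Theorems.Transplant.SkelFrmBParamsSlots
import Summits.CriticalPhenomena.PercolationContinuityZ3.Theorems.Transplant.SkelFrmBParamsSched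
import Summits.CriticalPhenomena.PercolationContinuityZ3.Theorems.Transplant.SkelNegBParamsFoot
import Summits.CriticalPhenomena.PercolationContinuityZ3.Theorems.Transplant.PlanarSkeletonFrmDefs
import Summits.CriticalPhenomena.PercolationContinuityZ3.Theorems.Transplant.SkelPhiStepIDataNS
import HarnessLib

/-!
# N2 (frames-only node `SamePDropOfSkeletonFrm₁`, OPEN) params column over `PlanarSkeletonFrm` — (ζ″) ledger, shape (B′) of record ((R-14)):
# MECHANICAL PORT of N1's `SkelNegBParamsFoot` — chain of record `NegB`, part Foot: ANISOTROPIC FINE CONTAINMENT — the per-axis twin of hp-8's `fine_containment` / p3-g9's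
# `abs_fineSkel_le_of_near`: planar extents `sα` (axis 0) and `sβ` (axis 1) SEPARATELY give fine extents `k₀, k₁` as soon as `c₀·|A|·(|vβ|·sα + |vα|·sβ) ≤ k₀·D` and … (N1
# title abridged; see `SkelNegBParamsFoot`)
builds on p205010 (kernel theorem, internal audit signed; external expert review pending) — nothing in this file uses p205010; NOTHING is claimed about the
open node `SamePDropOfSkeletonFrm₁` (`SamePDropOfSkeletonNeg₁` is CLOSED in the tree and untouched by this file).
Status sentence (coordinator 2026-08-20T04:30Z): "θ(p_c) = 0 on ℤ^d, all d ≥ 2 — kernel-verified (Lean 4/Mathlib, standard axioms); internal adversarial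
audit SIGNED 2026-08-20 04:29Z; external expert review pending."
Lane `prim-bschramm-*`, seat `prim-bschramm-stmt` (gen 19); helper file (`--supports stmt-CriticalPhenomena-4575 --as helper`); ledger HOME/prim-bschramm-stmt/FRM-PARAMS.md §9, (R-14).
PORT RULES (HOME/prim-bschramm-stmt-g19/lean/port_frm.py, the tool of record per (R-14)): outer namespace `PlanarSkeletonNeg ↦ PlanarSkeletonFrm`, carrier binder
`(Φ : PlanarSkeletonFrm G)`, record binder `(D : Skelφ.StepI.DataNS V)` (the selectors travel IN the record, `SkelPhiStepIDataNS`); section variables INLINED into every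
declaration header; inner namespaces (`Neg`/`NegB`/`KS`/…) and every short name KEPT so all cross-references resolve unchanged; declarations using no section variable are
NOT re-declared (N1's originals are referenced fully qualified). Mathematical content, proofs, docstrings and citations are N1's, verbatim, except where stated next.
SELECTORS IN THIS FILE ((R-14) condition of record — joint selection, `D.sN`'s first argument is the literal handed to `D.sM`): none (pure port; the pairs are read through their N1 names).
N1 HEADER (kept for the reader):
helper file (`--supports stmt-CriticalPhenomena-4575 --as helper`); ledger HOME/prim-bschramm-stmt/NEG-PARAMS.md v0.12.
* §1 **`fine_containment₂`** (any fine skeleton, two planar extents), **`abs_fineSkel_le_of_near₂`** (about the base vertex, offsets `D/2`);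
* §2 at the frame record `prF`: **`kFoot₀ sα sβ`, `kFoot₁ sα sβ`** (`:= ⌈c_i·|A|·(…)/D⌉` as floor + 1), **`hL0_R/hL1_R`**, `kFoot_nonneg`, and the packaged reading
  **`abs_fine_le_of_near₂`** (`|φ′ w i − φ′ t i| ≤ (sα, sβ)_i ⇒ |fine … φ′ w i| ≤ kFoot_i`);
* §3 **`fine_containment_lam₂`**, **`abs_fineSkel_le_of_lam₂`** (bounds on the lattice functionals `v_βΔ₀ − v_αΔ₁`, `nΔ₁ − hΔ₀` instead of per-axis extents — exact
  for sheared regions), **`lam_bounds_of_mem_pgramCyl`** (the long parallelogram: `≤ m + n·L`, `≤ n·L`).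
[cite: KozmaNitzan2024, §4 Lemma 10 Step IV; Lemma 12 (pp. 23–25)] [cite: MartineauTassion2017, §4.3]
-/

noncomputable section

open scoped Classical

namespace Summit.CriticalPhenomena.PercolationContinuityZ3.Theorems.Transplant

/-! ## §1 Anisotropic fine containment -/

namespace Skelφ

open Literature.Probability.LatticeModels TwoAxis.Para

end Skelφ

/-! ## §2 The fine extents of record for a planar box at the frame record -/

namespace PlanarSkeletonFrm

namespace NegB

open Literature.Probability.Percolation Literature.Probability.LatticeModels SimpleGraph
open SkelConc (Consts)
open Skelφ.StepI (DataN)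
open TwoAxis.Para (modulus)
open Neg

section Values

/-- **The fine extent on axis `0`** of the planar box `[±sα] × [±sβ]`: `kFoot₀ := ⌈c₀·|A|·(|vβ|·sα + |vα|·sβ)/D⌉` (floor + 1). [this work] -/
def kFoot₀ (κ : Consts) {V : Type} [DecidableEq V] [Countable V] {G : SimpleGraph V} [G.LocallyFinite] (Φ : PlanarSkeletonFrm G) (t : V) (p : unitInterval) (D : Skelφ.StepI.DataNS V) (g : ℕ) (f : ℕ) (sα : ℤ) (sβ : ℤ) : ℤ := (prF κ Φ t p D g f).c₀ * (|(prF κ Φ t p D g f).A| * (|(prF κ Φ t p D g f).vβ| * sα + |(prF κ Φ t p D g f).vα| * sβ)) / (prF κ Φ t p D g f).D + 1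

/-- **The fine extent on axis `1`**: `kFoot₁ := ⌈c₁·|A|·(|n|·sβ + |h|·sα)/D⌉` (floor + 1). [this work] -/
def kFoot₁ (κ : Consts) {V : Type} [DecidableEq V] [Countable V] {G : SimpleGraph V} [G.LocallyFinite] (Φ : PlanarSkeletonFrm G) (t : V) (p : unitInterval) (D : Skelφ.StepI.DataNS V) (g : ℕ) (f : ℕ) (sα : ℤ) (sβ : ℤ) : ℤ := (prF κ Φ t p D g f).c₁ * (|(prF κ Φ t p D g f).A| * (|(prF κ Φ t p D g f).n| * sβ + |(prF κ Φ t p D g f).h| * sα)) / (prF κ Φ t p D g f).D + 1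

/-- **`hL0`** at `k₀ := kFoot₀`. [folklore] -/
theorem hL0_R (κ : Consts) {V : Type} [DecidableEq V] [Countable V] {G : SimpleGraph V} [G.LocallyFinite] (Φ : PlanarSkeletonFrm G) (t : V) (p : unitInterval) (D : Skelφ.StepI.DataNS V) (g : ℕ) (f : ℕ) (sα : ℤ) (sβ : ℤ) (hN : EqNumL κ Φ t p D g f) :
    (prF κ Φ t p D g f).c₀ * (|(prF κ Φ t p D g f).A| * (|(prF κ Φ t p D g f).vβ| * sα + |(prF κ Φ t p D g f).vα| * sβ)) ≤ kFoot₀ κ Φ t p D g f sα sβ * (prF κ Φ t p D g f).D := by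
  have hD := (prF_pos κ Φ t p D g f hN).2.2.2.2.2
  unfold kFoot₀; rw [mul_comm _ (prF κ Φ t p D g f).D]; exact ceil_mul_le hD

/-- **`hL1`** at `k₁ := kFoot₁`. [folklore] -/
theorem hL1_R (κ : Consts) {V : Type} [DecidableEq V] [Countable V] {G : SimpleGraph V} [G.LocallyFinite] (Φ : PlanarSkeletonFrm G) (t : V) (p : unitInterval) (D : Skelφ.StepI.DataNS V) (g : ℕ) (f : ℕ) (sα : ℤ) (sβ : ℤ) (hN : EqNumL κ Φ t p D g f) :
    (prF κ Φ t p D g f).c₁ * (|(prF κ Φ t p D g f).A| * (|(prF κ Φ t p D g f).n| * sβ + |(prF κ Φ t p D g f).h| * sα)) ≤ kFoot₁ κ Φ t p D g f sα sβ * (prF κ Φ t p D g f).D := by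
  have hD := (prF_pos κ Φ t p D g f hN).2.2.2.2.2
  unfold kFoot₁; rw [mul_comm _ (prF κ Φ t p D g f).D]; exact ceil_mul_le hD

/-- `0 ≤ kFoot₀`, `0 ≤ kFoot₁` for nonnegative extents (under the numeric long clause). [folklore] -/
theorem kFoot_nonneg (κ : Consts) {V : Type} [DecidableEq V] [Countable V] {G : SimpleGraph V} [G.LocallyFinite] (Φ : PlanarSkeletonFrm G) (t : V) (p : unitInterval) (D : Skelφ.StepI.DataNS V) (g : ℕ) (f : ℕ) (sα : ℤ) (sβ : ℤ) (hN : EqNumL κ Φ t p D g f) (hα : 0 ≤ sα) (hβ : 0 ≤ sβ) : 0 ≤ kFoot₀ κ Φ t p D g f sα sβ ∧ 0 ≤ kFoot₁ κ Φ t p D g f sα sβ := by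
  obtain ⟨-, -, -, hc₀, hc₁, hD⟩ := prF_pos κ Φ t p D g f hN
  constructor
  · unfold kFoot₀
    have : 0 ≤ (prF κ Φ t p D g f).c₀ * (|(prF κ Φ t p D g f).A| * (|(prF κ Φ t p D g f).vβ| * sα + |(prF κ Φ t p D g f).vα| * sβ)) / (prF κ Φ t p D g f).D :=
      Int.ediv_nonneg (by positivity) hD.le
    linarith
  · unfold kFoot₁
    have : 0 ≤ (prF κ Φ t p D g f).c₁ * (|(prF κ Φ t p D g f).A| * (|(prF κ Φ t p D g f).n| * sβ + |(prF κ Φ t p D g f).h| * sα)) / (prF κ Φ t p D g f).D :=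
      Int.ediv_nonneg (by positivity) hD.le
    linarith

/-- **THE PACKAGED READING** (map slot `φ′`): a vertex within planar extents `(sα, sβ)` of the base vertex `t` has fine position within `(kFoot₀, kFoot₁)`. [folklore] -/
theorem abs_fine_le_of_near₂ (κ : Consts) {V : Type} [DecidableEq V] [Countable V] {G : SimpleGraph V} [G.LocallyFinite] (Φ : PlanarSkeletonFrm G) (t : V) (p : unitInterval) (D : Skelφ.StepI.DataNS V) (g : ℕ) (f : ℕ) (sα : ℤ) (sβ : ℤ) (hN : EqNumL κ Φ t p D g f) {φ' : V → Site 2} {w : V} (h0 : |φ' w 0 - φ' t 0| ≤ sα) (h1 : |φ' w 1 - φ' t 1| ≤ sβ) :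
    |fine κ Φ t p D g f φ' w 0| ≤ kFoot₀ κ Φ t p D g f sα sβ ∧ |fine κ Φ t p D g f φ' w 1| ≤ kFoot₁ κ Φ t p D g f sα sβ := by
  obtain ⟨-, -, -, hc₀, hc₁, hD⟩ := prF_pos κ Φ t p D g f hN
  have hψ : fine κ Φ t p D g f φ' = (prF κ Φ t p D g f).ψ φ' t := (prF_ψ κ Φ t p D g f φ').symm
  have h := Skelφ.fine_containment₂ (φ := φ') t (s₀ := (prF κ Φ t p D g f).D / 2) (s₁ := (prF κ Φ t p D g f).D / 2) hD hc₀.le hc₁.le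
    (hL0_R κ Φ t p D g f sα sβ hN) (hL1_R κ Φ t p D g f sα sβ hN) h0 h1
  have h0' := fine_base_at κ Φ t p D g f φ' hN
  rw [hψ] at h0' ⊢
  unfold Skelφ.FinePrm.ψ at h h0' ⊢
  rw [h0'] at h
  simpa using h

end Values

end NegB

end PlanarSkeletonFrm

/-! ## §3 Fine containment from the LATTICE FUNCTIONALS (located stmt-g14 2026-08-21T19:4xZ: per-axis extents still over-read a sheared region — steep long pair
`|h_L| ≈ 10 n_L` with `n_L ≫ ℓ_L`; the functionals `v_β·Δ₀ − v_α·Δ₁` and `n·Δ₁ − h·Δ₀` are read directly) -/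

namespace Skelφ

open Literature.Probability.LatticeModels TwoAxis.Para

end Skelφ

end Summit.CriticalPhenomena.PercolationContinuityZ3.Theorems.Transplant

end
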